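import Mathlib
import Summits.Ventures.HodgeRepro.Tier4.Line4.SublevelOfVolume
import Summits.Ventures.HodgeRepro.Tier4.Line4.GASplit
import Summits.Ventures.HodgeRepro.Tier4.Line4.OrbitDecay

/-!
# Tier4/Line4/ArchBallReduce — C-L4-ARCHBALL-REDUCE: the volume growth of `G(𝔸)` reduces to the archimedean ball

Blind re-derivation cell `pub-hodge-repro`, Tier 4 «prove the step» (README §9–§10), seat t4-L4-p2 (prover, LINE L4,
gen 4; cut C-L4-ARCHBALL-REDUCE, plan-4 g5 S15402, statement S15436).  Tree path
`lean/Summits/Ventures/HodgeRepro/Tier4/Line4/ArchBallReduce.lean`.  One `def` (the narrowed print); no literature.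

THE STATEMENT.  `VolumeGrowth W S` (SublevelOfVolume, the print-shaped display of (8): `S.μ {g | g_f ∈ Kf′ ∧ archDist g ≤ T}
≤ C e^{αT}`, `α < 3`, for every compact `Kf′ ⊆ G(𝔸_f)`) follows from the ONE archimedean statement
`ArchBallGrowth W μ∞` — `μ∞ {a ∈ G_∞ | archDist a ≤ T} ≤ C e^{αT}`, `α < 3` — once `S.μ` is transported to `μ∞ ⊗ μ_f` along
L4-p1's splitting `gaSplit : G(𝔸) ≃ₜ* G_∞ × G_f` (`volumeGrowth_of_archBallGrowth`, the transport equation as the binder;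
`volumeGrowth_of_archBallGrowth'`, the transport discharged by Haar uniqueness `exists_smul_map_prod_eq_ga` when `S.μ` is
Haar).  The remaining print of (S-COUNT) is `ArchBallGrowth` alone: the `U(1,1)_{w₀}` ball `≍ T e^{2T}` in `archDist`
coordinates (`α = 2 + ε < 3`), the definite places contributing a bounded `archDist` (compact tori) — lit-3's rows 48–50
(S15388).  `VolumeGrowth` stays the display of record; this module only narrows its print (crit-1 PRINT RULE S15295).

THE PROOF.  For EVERY set `s ⊆ G(𝔸)`, `(map gaSplit⁻¹ (μ∞ ⊗ μ_f)) s = (μ∞ ⊗ μ_f)(gaSplit⁻¹ ⁻¹' s)` (the splitting is a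
measurable equivalence — no measurability of the sublevel set is needed); the preimage of `{g | g_f ∈ Kf′ ∧ archDist g ≤ T}`
is EXACTLY `{a | archDist a ≤ T} ×ˢ {b | b ∈ Kf′}` because `(a b)_f = b` and `archDist (a b) = archDist (ofInfPart (a b)) =
archDist a` (`archDist_ofInfPart`, L2-p3's OrbitDecay); `prod_prod`; `μ_f {b | b ∈ Kf′} < ∞` (`Kf′` compact, Haar finite on
compacts); `C := c · μ_f(Kf′).toReal · C_ball`, the same `α`.

Nothing here says anything about the status of the Hodge conjecture for CM abelian varieties, which is NOT proved
(HC_CM is NOT proved by anyone in this repository).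
-/

set_option autoImplicit false

noncomputable section

namespace Summit.Ventures.HodgeRepro.Tier4.Line4

open Summit.Ventures.HodgeRepro.Tier4 Summit.Ventures.HodgeRepro.Tier4.Common Summit.Ventures.HodgeRepro.Tier4.Line1
  Summit.Ventures.HodgeRepro.Tier4.Line4.L1Class MeasureTheory NumberField Topology

open scoped Pointwise ENNReal NNReal

variable {k : Type} [Field k] [NumberField k] (W : PlaneData k) [MeasurableSpace (GA W)] [BorelSpace (GA W)]

/-- **The archimedean ball growth** (the narrowed print of (S-COUNT), plan-4 g5 S15402): the `archDist`-balls of `G_∞`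
have `μ∞`-measure at most `C e^{αT}` with `α < 3`. -/
def ArchBallGrowth (μinf : Measure (infinitePart W)) : Prop :=
  ∃ C α : ℝ, 0 ≤ C ∧ α < 3 ∧ ∀ T : ℝ,
    μinf {a : infinitePart W | archDist W (a : GA W) ≤ T} ≤ ENNReal.ofReal (C * Real.exp (α * T))

omit [MeasurableSpace (GA W)] [BorelSpace (GA W)] in
/-- The finite part of a product `a · b`, `a ∈ G_∞`, `b ∈ G_f`, is `b`. -/
theorem ofFinPart_coe_mul_coe (a : infinitePart W) (b : finitePart W) :
    GA.ofFinPart W ((a : GA W) * (b : GA W)) = (b : GA W) := by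
  rw [ofFinPart_mul, ofFinPart_eq_one_of_mem_infinitePart W a.2, ofFinPart_eq_self_of_mem_finitePart W b.2, one_mul]

omit [MeasurableSpace (GA W)] [BorelSpace (GA W)] in
/-- The archimedean distance of a product `a · b`, `a ∈ G_∞`, `b ∈ G_f`, is that of `a`. -/
theorem archDist_coe_mul_coe (a : infinitePart W) (b : finitePart W) :
    archDist W ((a : GA W) * (b : GA W)) = archDist W (a : GA W) := by
  rw [← archDist_ofInfPart W ((a : GA W) * (b : GA W)), ofInfPart_mul,
    ofInfPart_eq_self_of_mem_infinitePart W a.2, ofInfPart_eq_one_of_mem_finitePart W b.2, mul_one]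

omit [MeasurableSpace (GA W)] [BorelSpace (GA W)] in
/-- The preimage of the truncated sublevel set under the splitting is a product set. -/
theorem preimage_gaSplit_symm_sublevel (Kf' : Set (GA W)) (T : ℝ) :
    (gaSplit W).symm ⁻¹' {g : GA W | GA.ofFinPart W g ∈ Kf' ∧ archDist W g ≤ T} =
      {a : infinitePart W | archDist W (a : GA W) ≤ T} ×ˢ {b : finitePart W | (b : GA W) ∈ Kf'} := by
  ext ⟨a, b⟩
  simp only [Set.mem_preimage, gaSplit_symm_apply, Set.mem_setOf_eq, Set.mem_prod, ofFinPart_coe_mul_coe,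
    archDist_coe_mul_coe]
  exact and_comm

omit [MeasurableSpace (GA W)] [BorelSpace (GA W)] in
/-- A compact subset of `G(𝔸)` contained in `G_f` is compact as a subset of `G_f`. -/
theorem isCompact_preimage_val_finitePart {Kf' : Set (GA W)} (hKf' : IsCompact Kf') :
    IsCompact {b : finitePart W | (b : GA W) ∈ Kf'} :=
  (isClosed_finitePart W).isClosedEmbedding_subtypeVal.isCompact_preimage hKf'

/-- **THE REDUCTION** (C-L4-ARCHBALL-REDUCE): with `S.μ = c • (gaSplit⁻¹)_*(μ∞ ⊗ μ_f)` (L4-p1's Haar transport), the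
archimedean ball growth `ArchBallGrowth W μ∞` gives `VolumeGrowth W S` — the constant is `c · μ_f(Kf′) · C`, the rate `α`
is unchanged. -/
theorem volumeGrowth_of_archBallGrowth (S : RTF.Setting (GA W))
    (μinf : Measure (infinitePart W)) [μinf.IsHaarMeasure] (μfin : Measure (finitePart W)) [μfin.IsHaarMeasure]
    (c : ℝ≥0) (hc : S.μ = c • Measure.map (gaSplit W).symm (μinf.prod μfin)) (hball : ArchBallGrowth W μinf) :
    VolumeGrowth W S := by
  haveI := locallyCompact_infinitePart W
  haveI := locallyCompact_finitePart W
  haveI := secondCountable_infinitePart W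
  haveI := secondCountable_finitePart W
  intro Kf' hKf' _hKf'sub
  obtain ⟨C, α, hC, hα, hT⟩ := hball
  have hfin : μfin {b : finitePart W | (b : GA W) ∈ Kf'} ≠ ∞ :=
    (isCompact_preimage_val_finitePart W hKf').measure_lt_top.ne
  refine ⟨(c : ℝ) * (μfin {b : finitePart W | (b : GA W) ∈ Kf'}).toReal * C, α, ?_, hα, fun T => ?_⟩
  · exact mul_nonneg (mul_nonneg c.2 ENNReal.toReal_nonneg) hC
  have hmeq : Measure.map (gaSplit W).symm (μinf.prod μfin) =
      Measure.map ((gaSplit W).symm.toHomeomorph.toMeasurableEquiv) (μinf.prod μfin) := rfl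
  have hsm : ∀ s : Set (GA W), S.μ s = (c : ℝ≥0∞) * (μinf.prod μfin) ((gaSplit W).symm ⁻¹' s) := by
    intro s
    rw [hc, Measure.smul_apply, hmeq, MeasurableEquiv.map_apply, ENNReal.smul_def]
    rfl
  rw [hsm, preimage_gaSplit_symm_sublevel, Measure.prod_prod]
  calc (c : ℝ≥0∞) * (μinf {a : infinitePart W | archDist W (a : GA W) ≤ T} *
        μfin {b : finitePart W | (b : GA W) ∈ Kf'})
      ≤ (c : ℝ≥0∞) * (ENNReal.ofReal (C * Real.exp (α * T)) * μfin {b : finitePart W | (b : GA W) ∈ Kf'}) := by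
        gcongr
        exact hT T
    _ = ENNReal.ofReal ((c : ℝ) * (μfin {b : finitePart W | (b : GA W) ∈ Kf'}).toReal * C * Real.exp (α * T)) := by
        rw [ENNReal.ofReal_mul (mul_nonneg (mul_nonneg c.coe_nonneg ENNReal.toReal_nonneg) hC),
          ENNReal.ofReal_mul (mul_nonneg c.coe_nonneg ENNReal.toReal_nonneg), ENNReal.ofReal_mul c.coe_nonneg,
          ENNReal.ofReal_toReal hfin, ENNReal.ofReal_coe_nnreal, ENNReal.ofReal_mul hC]
        ring

/-- **The reduction with the transport discharged**: for a Haar `S.μ`, `ArchBallGrowth W μ∞` for some Haar `μ∞` on `G_∞`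
(and any Haar `μ_f` on `G_f`) gives `VolumeGrowth W S` — the transport `S.μ = c • (gaSplit⁻¹)_*(μ∞ ⊗ μ_f)` is Haar
uniqueness on `G(𝔸)` (`exists_smul_map_prod_eq_ga`). -/
theorem volumeGrowth_of_archBallGrowth' (S : RTF.Setting (GA W)) [S.μ.IsHaarMeasure]
    (μinf : Measure (infinitePart W)) [μinf.IsHaarMeasure] (μfin : Measure (finitePart W)) [μfin.IsHaarMeasure]
    (hball : ArchBallGrowth W μinf) : VolumeGrowth W S := by
  obtain ⟨c, -, hc⟩ := exists_smul_map_prod_eq_ga W S.μ μinf μfin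
  exact volumeGrowth_of_archBallGrowth W S μinf μfin c hc hball

end Summit.Ventures.HodgeRepro.Tier4.Line4

end
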